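import Literature.AnabelianGeometry.EtaleTheta.Discharge.Sec3Thm37UnitProfinite
import Literature.AnabelianGeometry.EtaleTheta.TemperedFrobenioidLaws
import HarnessLib

/-!
# [EtTh] Theorem 3.7 (iv) — NODE CLOSER AS TYPED (`TemperedFrobenioid.Thm37_iv`), print's `Λ ∈ {ℤ, ℝ}` casing
# done inside, with the node's own binders only

S. Mochizuki, *The étale theta function and its Frobenioid-theoretic manifestations*, Publ. RIMS **45**
(2009) [EtTh], §3, Theorem 3.7 (iv): statement PDF p. 80 (printed p. 306) l. 7, proof ibid. ll. 23–25 of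
`paper:doi-10-2977-prims-1234361159` [cite: MochizukiEtTh2009, Thm 3.7 (iv) p.80]:

> "(iv) If `D` is slim [cf. [Mzk17], §0], and `Λ ∈ {ℤ, ℝ}`, then `C` is also slim."
> Proof: "Assertion (iv) follows formally from [Mzk17], Proposition 1.13, (iii) [since, by assertion (i) of
> the present Theorem 3.7, 'condition (b)' of loc. cit. is always satisfied by objects of `C`]."

Proof-only companion (theorems only: no `def`, no `Prop` fact, no instance; abc-iut cell, layer L2, cone node
**`EtTh:Thm3.7(iv)`**; R-C «per-node clause coverage», seat abc-iut-w4-d103).  abc-iut-L2-t3's typed node statement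
`TemperedFrobenioid.Thm37_iv C₀ : Prop := IsSlim D → (Λ = ℤ ∨ Λ = ℝ) → IsSlim C₀.category` is facade-FREE (the
tree's `IsSlim` on both sides), so a theorem of type `C₀.Thm37_iv` IS the node as typed.  The closers exist per
monoid type (abc-iut-w5-d164: `thm37_iv_of_kerIsoPadicUnits` — `Λ = ℤ`, `Sec3Thm37UnitProfinite` p414441, from
unit-profinite type via Prop. 3.4 (ii) iso 1 and [FrdII] Thm 1.2 (i); `thm37_iv_of_divΛ_injective` — `Λ = ℝ`,
`Sec3Thm37Units` p414061, from unit-trivial type; both over abc-iut-L6-t13's `thm37_iv_of_isFrobenioid` = [FrdI]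
Prop. 1.13 (iii), `Sec3Thm37`), and the END KNIT `thm37_of_inputs` (p429227) performs print's case split — but as
conjunct (iv) of (i)–(iv), i.e. together with the (ii)/(iii) binders `hD hnd hrat hKfix P`.  THIS FILE isolates the
node: ONE theorem of type `C₀.Thm37_iv` whose binders are the node's own —

* `thm37_iv_node (hF) (hP34) (hinj)` — any vocabulary `VD`; residual = {`hF` ([FrdI] Thm 5.2 (ii) «`C` is a
  Frobenioid», the well-formedness claim inside Def. 3.6 (ii)), `hP34` (ONLY if `Λ = ℤ`: Prop. 3.4 (ii) first
  isomorphism in tree currency — print's "by assertion (i)", whose `Λ = ℤ` clause rests on Prop. 3.4 (ii)),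
  `hinj` (ONLY if `Λ = ℝ`: `B₀^ℝ → (Φ₀^ℝ)^gp` injective — a THEOREM at the constructed data `ofRlfR`)};
* `thm37_iv_node_treeCatVocab (hBmon) …` — at the canonical category vocabulary `hF` is L1's theorem
  `isFrobenioid_treeCatVocab_of_isMonoidOn hBmon` ([FrdI] Thm 5.2 (ii));
* `thm37_iv_node_of_laws (hB : C₀.BaseInj) (hFSM) …` — `hBmon` ⟸ the structure owner's NAMED LAW
  `TemperedFrobenioid.BaseInj` (abc-iut-L2-t3, census A9) + «FSM-morphisms of `D` are isomorphisms».
Companions of record not restated: `thm37_iv_of_structural` (abc-iut-L6-t13 p412380, binder `hdiv`),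
`Sec3Thm37ivGenuineBase` (abc-iut-w6-d048 p432030: at `D = B^temp(Π)⁰` the FSM clause and slimness of `D` are
THEOREMS), `Sec3Thm37ivBaseInjOfDivisorial` (abc-iut-w5-d179 p437182).

HONEST FRAMING: refereed pre-IUT material ([EtTh] §3 over [FrdI] Prop. 1.13, [FrdII] Thm 1.2 (i)); bookkeeping over
PROVED rows, no new mathematics; nothing here bears on [IUTchIII] Cor. 3.12; no statement of either paper is
strengthened; typed ≠ proved — here PROVED modulo the literal binders.
-/

namespace Literature.AnabelianGeometry.EtaleTheta

open CategoryTheory Opposite Literature.AlgebraicGeometry.Frobenioids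

namespace TemperedFrobenioid

universe u₀ v₀ u v w uK

section AnyVocab

variable {D₀ : Type u₀} [Category.{v₀} D₀] {V : FrdIMonoidStub.{w}}
  {T : RealifiedDivisorMonoids (D₀ := D₀) V} {D : Type u} [Category.{v} D]
  {VD : FrdICatStub.{u, v, w} D} (C₀ : TemperedFrobenioid T D VD) {p : ℕ} [Fact p.Prime]

/-- **[EtTh] Thm 3.7 (iv) — the node AS TYPED** (`C₀.Thm37_iv`: "`D` slim and `Λ ∈ {ℤ, ℝ}` ⇒ `C` slim"), over
ANY vocabulary, with print's case split done inside: `Λ = ℤ` ⇒ unit-profinite type (Prop. 3.4 (ii) iso 1 BY NAME,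
`hP34`) ⇒ no non-trivial divisible unit ⇒ slim by [FrdI] Prop. 1.13 (iii) (`thm37_iv_of_kerIsoPadicUnits`,
p414441); `Λ = ℝ` ⇒ unit-trivial type ("definition of the realification", `hinj`) ⇒ slim
(`thm37_iv_of_divΛ_injective`, p414061).  Residual = {`hF`, `hP34` (if `Λ = ℤ`), `hinj` (if `Λ = ℝ`)} — the node's
own inputs, no (ii)/(iii) binders. [cite: MochizukiEtTh2009, Thm 3.7 (iv) p.80] -/
theorem thm37_iv_node (hF : PreFrobenioid.IsFrobenioid C₀.toElem)
    (hP34 : C₀.monoidType = MonoidType.Z → ∀ A : Dᵒᵖ, ∃ L : PadicFrd.PadicFld.{uK} p, L.IsPadicLocal ∧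
      Nonempty (((T.divΛ (C₀.baseOp A)).comp (Units.coeHom (T.BΛ.obj (C₀.baseOp A)))).ker ≃*
        PadicFrd.unitSubgroup L.K))
    (hinj : C₀.monoidType = MonoidType.R → ∀ A : Dᵒᵖ, Function.Injective (T.divΛ (C₀.baseOp A))) :
    C₀.Thm37_iv := fun hslim hΛ =>
  hΛ.elim (fun hZ => C₀.thm37_iv_of_kerIsoPadicUnits hF (hP34 hZ) hslim (Or.inl hZ))
    fun hR => C₀.thm37_iv_of_divΛ_injective hF (hinj hR) hslim (Or.inr hR)

end AnyVocab

section TreeVocab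

variable {D₀ : Type u₀} [Category.{v₀} D₀] {V : FrdIMonoidStub.{w}}
  {T : RealifiedDivisorMonoids (D₀ := D₀) V} {D : Type u} [Category.{v} D]
  {IsRational IsStrictlyRational : (Dᵒᵖ ⥤ CommMonCat.{w}) → Prop}
  (C₀ : TemperedFrobenioid T D (treeCatVocab D IsRational IsStrictlyRational)) {p : ℕ} [Fact p.Prime]

/-- **The node AS TYPED at the canonical category vocabulary**: `hF` is L1's [FrdI] Thm 5.2 (ii)
(`isFrobenioid_treeCatVocab_of_isMonoidOn hBmon`), so the residual is {`hBmon`, `hP34` (if `Λ = ℤ`), `hinj` (if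
`Λ = ℝ`)}. [cite: MochizukiEtTh2009, Thm 3.7 (iv) p.80] -/
theorem thm37_iv_node_treeCatVocab (hBmon : IsMonoidOn C₀.ratFnFunctor)
    (hP34 : C₀.monoidType = MonoidType.Z → ∀ A : Dᵒᵖ, ∃ L : PadicFrd.PadicFld.{uK} p, L.IsPadicLocal ∧
      Nonempty (((T.divΛ (C₀.baseOp A)).comp (Units.coeHom (T.BΛ.obj (C₀.baseOp A)))).ker ≃*
        PadicFrd.unitSubgroup L.K))
    (hinj : C₀.monoidType = MonoidType.R → ∀ A : Dᵒᵖ, Function.Injective (T.divΛ (C₀.baseOp A))) :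
    C₀.Thm37_iv :=
  C₀.thm37_iv_node (C₀.isFrobenioid_treeCatVocab_of_isMonoidOn hBmon) hP34 hinj

/-- **The node AS TYPED from NAMED LAWS of the data**: `hBmon` ⟸ `TemperedFrobenioid.BaseInj` (census A9,
abc-iut-L2-t3) + «FSM-morphisms of `D` are isomorphisms» ([FrdI] Def. 1.1 (ii)(b); a theorem at the genuine base
`B^temp(Π)⁰`), via `isMonoidOn_ratFnFunctor_of_baseInj'`. [cite: MochizukiEtTh2009, Thm 3.7 (iv) p.80] -/
theorem thm37_iv_node_of_laws (hB : C₀.BaseInj) (hFSM : ∀ {A B : D} (α : B ⟶ A), IsFSM α → IsIso α)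
    (hP34 : C₀.monoidType = MonoidType.Z → ∀ A : Dᵒᵖ, ∃ L : PadicFrd.PadicFld.{uK} p, L.IsPadicLocal ∧
      Nonempty (((T.divΛ (C₀.baseOp A)).comp (Units.coeHom (T.BΛ.obj (C₀.baseOp A)))).ker ≃*
        PadicFrd.unitSubgroup L.K))
    (hinj : C₀.monoidType = MonoidType.R → ∀ A : Dᵒᵖ, Function.Injective (T.divΛ (C₀.baseOp A))) :
    C₀.Thm37_iv :=
  C₀.thm37_iv_node_treeCatVocab (p := p) (C₀.isMonoidOn_ratFnFunctor_of_baseInj' hB hFSM) hP34 hinj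

end TreeVocab

/-! ### At the GENUINE base `D = B^temp(Π)⁰`: the FSM clause is a theorem, `hBmon` ⟸ the base-image binder `hBD` -/

section ConnectedTemperoid

open Literature.AnabelianGeometry.SemiGraphs

variable {G : Type u} [Group G] [TopologicalSpace G] {D₀ : Type u₀} [Category.{v₀} D₀] {V : FrdIMonoidStub.{w}}
  {T : RealifiedDivisorMonoids (D₀ := D₀) V}
  {IsRational IsStrictlyRational : ((ConnectedPart (BTemp G))ᵒᵖ ⥤ CommMonCat.{w}) → Prop}
  (C₀ : TemperedFrobenioid T (ConnectedPart (BTemp G))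
    (treeCatVocab (ConnectedPart (BTemp G)) IsRational IsStrictlyRational)) {p : ℕ} [Fact p.Prime]

/-- **The node AS TYPED at the genuine base `B^temp(Π)⁰`** ([FrdII] Ex. 1.3 (i): `B^temp(Π)⁰` is of FSM-type, so
the FSM clause of «`B` a monoid on `D`» is a THEOREM, abc-iut-w5-d179's `isFrobenioid_connectedPart_of_baseInj`):
residual = {`hBD` (= the named law `BaseInj` at this base: pull-backs of `B₀^Λ` along the images of the morphisms of
`B^temp(Π)⁰` injective), `hP34` (if `Λ = ℤ`), `hinj` (if `Λ = ℝ`)}; «`D` slim» stays print's antecedent (it is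
[SemiAnbd] Ex. 3.10 for temp-slim `Π`, `isSlim_connectedPart_bTemp`, abc-iut-w6-d048's `Sec3Thm37ivGenuineBase`).
[cite: MochizukiEtTh2009, Thm 3.7 (iv) p.80] -/
theorem thm37_iv_node_connectedPart_of_baseInj
    (hBD : ∀ {A B : ConnectedPart (BTemp G)} (α : B ⟶ A), Function.Injective (T.BΛ.map (C₀.base.map α).op).hom)
    (hP34 : C₀.monoidType = MonoidType.Z → ∀ A : (ConnectedPart (BTemp G))ᵒᵖ, ∃ L : PadicFrd.PadicFld.{uK} p,
      L.IsPadicLocal ∧ Nonempty (((T.divΛ (C₀.baseOp A)).comp (Units.coeHom (T.BΛ.obj (C₀.baseOp A)))).ker ≃*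
        PadicFrd.unitSubgroup L.K))
    (hinj : C₀.monoidType = MonoidType.R → ∀ A : (ConnectedPart (BTemp G))ᵒᵖ,
      Function.Injective (T.divΛ (C₀.baseOp A))) :
    C₀.Thm37_iv :=
  C₀.thm37_iv_node (C₀.isFrobenioid_connectedPart_of_baseInj hBD) hP34 hinj

end ConnectedTemperoid

end TemperedFrobenioid

end Literature.AnabelianGeometry.EtaleTheta
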